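import Mathlib.Probability.Martingale.Basic
import Mathlib.Probability.Process.Stopping
import Mathlib.Analysis.SpecialFunctions.Pow.Asymptotics
import Literature.Probability.RandomPlanarGeometry.SLEDerivRatioLimit
import Literature.Probability.RandomPlanarGeometry.LoewnerCotArgExit
import Literature.Probability.RandomPlanarGeometry.RohdeSchrammGhat
import Literature.Probability.RandomPlanarGeometry.LocalMartingaleProofs
import HarnessLib

/-!
# Rohde–Schramm's martingale `Mₜ = ψₜ^a Ĝ(zₜ)` and Lemma 6.3 for `κ ≥ 8`

Trunk T-STOCH; layer 4c of the decomposition of the space-filling phase of SLE_κ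
(`Literature.Probability.RandomPlanarGeometry.ae_isSpaceFilling_sleTrace_of_eight_le`;
Rohde–Schramm, Ann. Math. 161 (2005), Cor. 7.4 and its Update, p. 911). Layers 1–2
(`CritPercSLESpaceFilling`, `SLETraceDensity`) reduced the target to four core theorems, among
them **Lemma 6.3, case `κ ≥ 8`** (`tendsto_sleDerivRatio_atTop_of_eight_le`: for `z ∈ ℍ`, a.s.
`Z(z) = lim_{t↑τ(z)} ψₜ = ∞`, `ψₜ = (Im z) |gₜ'(z)| / Im gₜ(z)`); layers 3a/3b/4a/4b
(`LoewnerDerivRatio`, `SLEDerivRatioLimit`, `LoewnerCotArgExit`, `RohdeSchrammGhat`) proved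
the deterministic content of its printed proof ((6.3); the dichotomy for `Z`; the exit time
`T = inf{t : |wₜ| = s}` of the slope `wₜ = xₜ/yₜ` of `zₜ = gₜ(z) - Wₜ` and "`|wₜ| ≤ s` for all
`t` forces `ψₜ → ∞`"; the hypergeometric `Ĝ_{a,κ}` and `Ĝ(s + i) → ∞` for `κ ≥ 8`).

This file supplies the remaining, genuinely stochastic step as ONE named fact and proves
Lemma 6.3 (`κ ≥ 8`) from it, following the printed proof (pp. 904–906):

* `Literature.Probability.RandomPlanarGeometry.Loewner.rsObservable a κ W z t = ψₜ^a Ĝ_{a,κ}(zₜ)`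
  (Rohde–Schramm's `Mₜ`, p. 904), set to `0` from the swallowing time `T_z` on (this is its
  limit as `t ↑ T_z` along paths with `|w|` bounded, the only ones on which the value is read);
  `sleRSObservable`, `sleCotArgExitTime` are the SLE_κ instances (driving function `√κ B`);
* the named fact `Literature.Probability.RandomPlanarGeometry.sle_martingale_rsObservable`
  — **the Itô step** ("A direct application of Itô's formula shows that `Mₜ` is a local
  martingale", p. 904; "`M_{t∧tₙ}` is a martingale … the optional sampling theorem then gives
  `Ĝ(ẑ) = M₀ = E[M_{T∧tₙ}]`", p. 905): for `κ > 0`, `a < 0` with real parameters `η₀, η₁`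
  (non-negative discriminant), `z ∈ ℍ` and a level `s`, the observable stopped at the exit time
  `T` of `|w|` from `[0, s)` is a martingale for the raw Brownian filtration under the pre-Wiener
  measure (a bounded local martingale: `0 < ψ^a ≤ 1`, `Ĝ(z_{t∧T})` bounded);
* `Literature.Probability.RandomPlanarGeometry.tendsto_sleDerivRatio_atTop_of_eight_le_of_martingale`
  — **Lemma 6.3 (`κ ≥ 8`) PROVED from the Itô step**, with the exponent `a = a(κ) = -(κ-4)²/(8κ)`
  of layer 4b (`η₀ = η₁`; `a = -1/4` at `κ = 8`): by the martingale identity and dominated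
  convergence `E[M_{T_m}; T_m < ∞] = Ĝ(z)` for the levels `s_m ↑ ∞` ("`Ĝ(ẑ) = M₀ = E[M_{T_m}]`",
  p. 905); on the event `{ψ ≤ k on [0, τ)}` the exit time `T_m` is finite (else `ψ → ∞`, layer
  4a) and `M_{T_m} = ψ_{T_m}^a Ĝ(s_m + i) ≥ k^a Ĝ(s_m + i)`, so by Markov's inequality
  `P[ψ ≤ k on [0, τ)] ≤ k^{-a} Ĝ(z) / Ĝ(s_m + i) → 0` as `m → ∞` ("`Ĝ(1) = ∞`", layer 4b);
  hence a.s. `ψ` is unbounded on `[0, τ(z))`, i.e. (being non-decreasing) `ψₜ → ∞`. This is the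
  printed passage "`Ĝ(ẑ) = M₀ = E[M_{T_m}] → L G(ẑ)` … unless `L = ∞`, which happens if and
  only if `G(ẑ) = 0`", "This implies that `Z = ∞` a.s. when `κ > 8`", "`Ĝ_{·,8}(1) = ∞` … so that
  the above argument applies" (pp. 905–906), run quantitatively;
* the end-to-end reductions `tendsto_integral_derivRatioRate_atTop_of_eight_le_of_martingale`
  (the integral form (6.3)) and
  `Literature.Probability.RandomPlanarGeometry.ae_isSpaceFilling_sleTrace_of_eight_le_of_itoFacts`:
  **the space-filling phase follows from LSW04 Thm 4.7, RS05 Thm 5.1, RS05 Thm 7.1 and the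
  Itô step**, everything else being proved in `Literature`.

## Mathlib

We USE `MeasureTheory.Martingale` / `Martingale.setIntegral_eq`, `MeasureTheory.stoppedProcess`
(stopping times valued in `WithTop ℝ≥0`), `tendsto_integral_of_dominated_convergence`,
`mul_meas_ge_le_integral_of_nonneg` (Markov), `aestronglyMeasurable_of_tendsto_ae`,
`tendsto_rpow_neg_atTop`, `Real.rpow_le_rpow_of_nonpos`. Mathlib has no Itô formula, no
Loewner chains and no SLE.

## References

* S. Rohde, O. Schramm, *Basic properties of SLE*, Ann. of Math. 161 (2005) 883–924: Lemma 6.3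
  and its proof (pp. 903–906), eqs. (6.3), (6.4); Cor. 7.4 and Update (p. 911).
* G. F. Lawler, O. Schramm, W. Werner, *Conformal invariance of planar loop-erased random walks
  and uniform spanning trees*, Ann. Probab. 32 (2004) 939–995, Thm 4.7.
-/

noncomputable section

open Set Filter Topology Metric MeasureTheory
open UpperHalfPlane (upperHalfPlaneSet isOpen_upperHalfPlaneSet)
open scoped NNReal

namespace Literature.Probability.RandomPlanarGeometry

/-! ### The observable `Mₜ = ψₜ^a Ĝ_{a,κ}(zₜ)` -/

namespace Loewner

variable {W : ℝ≥0 → ℝ} {z : ℂ}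

open Classical in
/-- **Rohde–Schramm's observable** `Mₜ := (ŷ |gₜ'(ẑ)| / yₜ)^a Ĝ_{a,κ}(zₜ) = ψₜ^a Ĝ_{a,κ}(zₜ)`
(Rohde–Schramm (2005), proof of Lemma 6.3, p. 904: "`Mₜ := (ŷ |gₜ'(ẑ)|/yₜ)^a Ĝ(zₜ)` is a local
martingale"), for the chain driven by `W`, the point `z` and the time `t < T_z`
(`derivRatio`, `centredMap`, `rsGhat`); **junk / limiting value `0` from the swallowing time
`T_z` on** (for `a < 0` this is the limit of `Mₜ` as `t ↑ T_z` along every path on which the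
slope `|wₜ|` stays bounded, `tendsto_derivRatio_atTop_of_abs_cotArg_le`; the value is only ever
read on such paths). Real power `Real.rpow` (the base `ψₜ ≥ 1` is positive).
[cite: RohdeSchramm2005, Lemma 6.3] -/
def rsObservable (a κ : ℝ) (W : ℝ≥0 → ℝ) (z : ℂ) (t : ℝ≥0) : ℝ :=
  if (t : WithTop ℝ≥0) < swallowingTime W z then
    derivRatio W z t ^ a * rsGhat a κ (centredMap W t z)
  else 0

/-- Before the swallowing time, `Mₜ = ψₜ^a Ĝ(zₜ)`. [folklore] -/
theorem rsObservable_of_lt {a κ : ℝ} {t : ℝ≥0} (ht : (t : WithTop ℝ≥0) < swallowingTime W z) :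
    rsObservable a κ W z t = derivRatio W z t ^ a * rsGhat a κ (centredMap W t z) := by
  rw [rsObservable, if_pos ht]

/-- From the swallowing time on, the observable is `0`. [folklore] -/
theorem rsObservable_of_le {a κ : ℝ} {t : ℝ≥0} (ht : swallowingTime W z ≤ (t : WithTop ℝ≥0)) :
    rsObservable a κ W z t = 0 := by
  rw [rsObservable, if_neg (not_lt.2 ht)]

/-- **`M₀ = Ĝ(z - W₀)`** (`ψ₀ = 1`, `z₀ = z - W₀`; for SLE `W₀ = 0` and `M₀ = Ĝ(ẑ)`, p. 905).
[cite: RohdeSchramm2005, Lemma 6.3] -/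
theorem rsObservable_zero {a κ : ℝ} (hW : Continuous W) (hz : 0 < z.im) :
    rsObservable a κ W z 0 = rsGhat a κ (z - W 0) := by
  have hzW : z ≠ W 0 := ne_driving_of_im_pos hz 0
  have h0 : ((0 : ℝ≥0) : WithTop ℝ≥0) < swallowingTime W z := swallowingTime_pos_holds hW hzW
  rw [rsObservable_of_lt h0, derivRatio_zero hW hz, Real.one_rpow, one_mul, centredMap_zero hW hzW]

/-- **The observable at the exponent `a(κ)`, `κ ≥ 8`, lies in `[0, Ĝ(|wₜ| + i)]`**: for
`t < T_z`, `0 ≤ Mₜ ≤ rsGhatW κ (wₜ)` (`0 < ψₜ^a ≤ 1` as `ψₜ ≥ 1`, `a ≤ 0`; `Ĝ = rsGhatW κ w ≥ 1`).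
This is "`Ĝ(z_{t∧T})` is bounded" (p. 905) together with "`1 ≤ ŷ |g_T'(ẑ)|/y_T`".
[cite: RohdeSchramm2005, Lemma 6.3] -/
theorem rsObservable_mem_Icc (hW : Continuous W) (hz : 0 < z.im) {κ : ℝ} (hκ : 8 ≤ κ) {t : ℝ≥0}
    (ht : (t : WithTop ℝ≥0) < swallowingTime W z) :
    rsObservable (rsExponent κ) κ W z t ∈
      Icc (0 : ℝ) (rsGhatW κ (cotArg W z t)) := by
  have hκ0 : κ ≠ 0 := by positivity
  have ha : rsExponent κ ≤ 0 := (rsExponent_neg (by linarith) (by linarith)).le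
  have hψ : 1 ≤ derivRatio W z t := one_le_derivRatio hW hz ht
  have hψpos : 0 < derivRatio W z t ^ rsExponent κ := Real.rpow_pos_of_pos (by linarith) _
  have hψle : derivRatio W z t ^ rsExponent κ ≤ 1 := Real.rpow_le_one_of_one_le_of_nonpos hψ ha
  have hy : (centredMap W t z).im ≠ 0 := (im_centredMap_pos hW hz ht).ne'
  have hG : rsGhat (rsExponent κ) κ (centredMap W t z) = rsGhatW κ (cotArg W z t) := by
    rw [rsGhat_rsExponent_eq hκ0 hy, cotArg_apply]
  have hGpos : 0 < rsGhatW κ (cotArg W z t) := rsGhatW_pos hκ _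
  rw [rsObservable_of_lt ht, hG]
  exact ⟨(mul_pos hψpos hGpos).le, by nlinarith⟩

/-- For every time `t` (before or after `T_z`) and a level `s` dominating `|wₜ|` when `t < T_z`:
`0 ≤ Mₜ ≤ rsGhatW κ s` (`κ ≥ 8`, exponent `a(κ)`). [cite: RohdeSchramm2005, Lemma 6.3] -/
theorem rsObservable_mem_Icc_of_abs_le (hW : Continuous W) (hz : 0 < z.im) {κ : ℝ} (hκ : 8 ≤ κ)
    {s : ℝ} {t : ℝ≥0}
    (hs : (t : WithTop ℝ≥0) < swallowingTime W z → |cotArg W z t| ≤ s) :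
    rsObservable (rsExponent κ) κ W z t ∈ Icc (0 : ℝ) (rsGhatW κ s) := by
  rcases lt_or_ge (t : WithTop ℝ≥0) (swallowingTime W z) with ht | ht
  · have h := rsObservable_mem_Icc hW hz hκ ht
    exact ⟨h.1, h.2.trans (rsGhatW_le_of_abs_le hκ (hs ht))⟩
  · rw [rsObservable_of_le ht]
    have hs0 : 0 < rsGhatW κ s := rsGhatW_pos hκ s
    exact ⟨le_rfl, hs0.le⟩

end Loewner

/-! ### The SLE_κ instances and the Itô step -/

section SLE

variable (κ : ℝ≥0) (a : ℝ) (z : ℂ) (s : ℝ)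

/-- Rohde–Schramm's observable `Mₜ(ω) = ψₜ^a Ĝ_{a,κ}(zₜ)` for the SLE_κ flow (driving function
`√κ B(ω)`), as a process `(t, ω) ↦ Mₜ(ω)` on the canonical space. [cite: RohdeSchramm2005, Lemma 6.3] -/
def sleRSObservable (t : ℝ≥0) (ω : ℝ≥0 → ℝ) : ℝ :=
  Loewner.rsObservable a κ (sleDriving κ ω) z t

/-- The exit time `T = inf{t < τ(z) : s ≤ |wₜ|}` of the slope of the SLE_κ flow from `z`, as a
random time valued in `WithTop ℝ≥0` (Rohde–Schramm's `T`, `T_m`, p. 905).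
[cite: RohdeSchramm2005, Lemma 6.3] -/
def sleCotArgExitTime (ω : ℝ≥0 → ℝ) : WithTop ℝ≥0 :=
  Loewner.cotArgExitTime (sleDriving κ ω) z s

end SLE

/-- **The Itô step of Rohde–Schramm's Lemma 6.3** (Ann. Math. 161 (2005), pp. 904–905: "A direct
application of Itô's formula shows that `Mₜ := (ŷ |gₜ'(ẑ)|/yₜ)^a Ĝ(zₜ)` is a local martingale"
— `dWₜ = √κ dBₜ`, `dzₜ = 2 dt/zₜ - dWₜ`, `∂ₜ log ψₜ = 4yₜ²/|zₜ|⁴`, and `Ĝ = Ĝ_{a,κ}` solves (6.9),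
`(4a y²/|z|⁴) Ĝ + (κ/2) ∂ₓ²Ĝ + (4x/|z|²) ∂ₓĜ = 0` — followed by "there is an increasing sequence of
stopping times `tₙ < τ(ẑ)` … such that `M_{t∧tₙ}` is a martingale. Set `t̄ₙ := T ∧ tₙ`. The
optional sampling theorem then gives `Ĝ(ẑ) = M₀ = E[M_{t̄ₙ}]`" and "`M₀ = E[M_{T_m∧tₙ}] → E[M_{T_m}]`",
`T = inf{t : |wₜ| = s}`), vendored as the statement actually consumed: for `κ > 0`, an
exponent `a < 0` with real parameters `η₀, η₁` (discriminant `32aκ + (2κ-8)² ≥ 0`, so that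
`Literature.Probability.RandomPlanarGeometry.rsGhat a κ` is the printed `Ĝ_{a,κ}`), `z ∈ ℍ` and
any level `s`, the observable stopped at the exit time of `|w|` from `[0, s)`,
`t ↦ M_{t ∧ T}` (`MeasureTheory.stoppedProcess`; on `{T = ∞}` read with the limiting value `0`
from `τ(z)` on, see `Loewner.rsObservable`), is a martingale with respect to the raw Brownian
filtration `Literature.Probability.RandomPlanarGeometry.brownianFiltration` under the pre-Wiener
measure. (It is a bounded local martingale — `0 < ψ^a ≤ 1`, `Ĝ(z_{t∧T})` bounded as
`|w_{t∧T}| ≤ max(s, |w₀|)` — hence a martingale; for `|w₀| ≥ s` or `s ≤ 0` the exit time is `0`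
and the statement is trivial.) Named fact (closed `Prop`; no proof here: it is the Itô step).
[cite: RohdeSchramm2005, Lemma 6.3] -/
def sle_martingale_rsObservable : Prop :=
  ∀ ⦃κ : ℝ≥0⦄, 0 < κ → ∀ ⦃a : ℝ⦄, a < 0 → 0 ≤ 32 * a * (κ : ℝ) + (2 * (κ : ℝ) - 8) ^ 2 →
    ∀ ⦃z : ℂ⦄, 0 < z.im → ∀ s : ℝ,
      Martingale (stoppedProcess (sleRSObservable κ a z) (sleCotArgExitTime κ z s))
        brownianFiltration Process.preWienerMeasure

/-! ### Pathwise facts about the stopped observable -/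

section Pathwise

variable {κ : ℝ≥0} {z : ℂ}

/-- The stopped clock `t ∧ T` (read in `ℝ≥0` through `WithTop.untopA`) is at most `T` and at
most `t` (cf. `Literature.Probability.Process.untopA_min_coe_le` of `ContinuousHitting` and
`Literature.Analysis.FunctionSpaces.coe_untopA_min_le` of `ItoProcessesProofs`, which state the
two halves separately; bundled here to keep the import closure small). [folklore] -/
theorem coe_untopA_min_le_and_le (t : ℝ≥0) (T : WithTop ℝ≥0) :
    (((min (t : WithTop ℝ≥0) T).untopA : ℝ≥0) : WithTop ℝ≥0) ≤ T ∧
      (min (t : WithTop ℝ≥0) T).untopA ≤ t := by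
  induction T with
  | top =>
    rw [min_eq_left le_top, WithTop.untopA_eq_untop WithTop.coe_ne_top, WithTop.untop_coe]
    exact ⟨le_top, le_rfl⟩
  | coe t₀ =>
    rw [← WithTop.coe_min, WithTop.untopA_eq_untop WithTop.coe_ne_top, WithTop.untop_coe]
    exact ⟨WithTop.coe_le_coe.2 (min_le_right _ _), min_le_left _ _⟩

/-- The slope of the SLE_κ flow from `z` at time `0` is `Re z / Im z` (`W₀ = 0`). [folklore] -/
theorem cotArg_sleDriving_zero (κ : ℝ≥0) (ω : ℝ≥0 → ℝ) (hz : 0 < z.im) :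
    Loewner.cotArg (sleDriving κ ω) z 0 = z.re / z.im := by
  have hW : Continuous (sleDriving κ ω) := continuous_sleDriving κ ω
  rw [Loewner.cotArg_apply, Loewner.centredMap_zero hW (Loewner.ne_driving_of_im_pos hz 0),
    sleDriving_zero, Complex.ofReal_zero, sub_zero]

/-- **`M₀ = Ĝ(ẑ)` for SLE** at the exponent `a(κ)` ("Note that `Ĝ(i) = 1`"; in general
`M₀ = Ĝ(ẑ) = rsGhatW κ (Re z / Im z)`, p. 905). [cite: RohdeSchramm2005, Lemma 6.3] -/
theorem sleRSObservable_zero {κ : ℝ≥0} (hκ : κ ≠ 0) (ω : ℝ≥0 → ℝ) (hz : 0 < z.im) :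
    sleRSObservable κ (rsExponent κ) z 0 ω = rsGhatW κ (z.re / z.im) := by
  have hW : Continuous (sleDriving κ ω) := continuous_sleDriving κ ω
  have hκ' : (κ : ℝ) ≠ 0 := by exact_mod_cast hκ
  rw [sleRSObservable, Loewner.rsObservable_zero hW hz, sleDriving_zero, Complex.ofReal_zero,
    sub_zero, rsGhat_rsExponent_eq hκ' hz.ne']

/-- The stopped observable at time `0` is `Ĝ(ẑ)`. [cite: RohdeSchramm2005, Lemma 6.3] -/
theorem stoppedProcess_sleRSObservable_zero {κ : ℝ≥0} (hκ : κ ≠ 0) (hz : 0 < z.im) (s : ℝ)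
    (ω : ℝ≥0 → ℝ) :
    stoppedProcess (sleRSObservable κ (rsExponent κ) z) (sleCotArgExitTime κ z s) 0 ω =
      rsGhatW κ (z.re / z.im) := by
  rw [stoppedProcess_eq_of_le (by exact bot_le), sleRSObservable_zero hκ ω hz]

/-- **The stopped observable lies in `[0, Ĝ(s + i)]`** when `|w₀| < s` (`κ ≥ 8`, exponent
`a(κ)`): at the stopped clock `u = t ∧ T ≤ T`, either `u < τ(z)` and then `|wᵤ| ≤ s`
(`Loewner.abs_cotArg_le_of_le_cotArgExitTime`), so `0 ≤ Mᵤ ≤ Ĝ(|wᵤ| + i) ≤ Ĝ(s + i)`, or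
`u ≥ τ(z)` and `Mᵤ = 0`. ("`Ĝ(z_{t∧T})` is bounded", p. 905.) [cite: RohdeSchramm2005, Lemma 6.3] -/
theorem stoppedProcess_sleRSObservable_mem_Icc {κ : ℝ≥0} (hκ : 8 ≤ (κ : ℝ)) (hz : 0 < z.im)
    {s : ℝ} (h0 : |z.re / z.im| < s) (t : ℝ≥0) (ω : ℝ≥0 → ℝ) :
    stoppedProcess (sleRSObservable κ (rsExponent κ) z) (sleCotArgExitTime κ z s) t ω ∈
      Icc (0 : ℝ) (rsGhatW κ s) := by
  have hW : Continuous (sleDriving κ ω) := continuous_sleDriving κ ω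
  have h0' : |Loewner.cotArg (sleDriving κ ω) z 0| < s := by rwa [cotArg_sleDriving_zero κ ω hz]
  obtain ⟨huT, -⟩ := coe_untopA_min_le_and_le t (sleCotArgExitTime κ z s ω)
  exact Loewner.rsObservable_mem_Icc_of_abs_le hW hz hκ fun hu ↦
    Loewner.abs_cotArg_le_of_le_cotArgExitTime hW hz h0' hu huT

/-- Before the swallowing time and with `|wₜ| ≤ s`: `Mₜ ≤ ψₜ^a Ĝ(s + i)` (`κ ≥ 8`, exponent
`a(κ)`). [cite: RohdeSchramm2005, Lemma 6.3] -/
theorem Loewner.rsObservable_le_rpow_mul {W : ℝ≥0 → ℝ} (hW : Continuous W) (hz : 0 < z.im)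
    {κ : ℝ} (hκ : 8 ≤ κ) {s : ℝ} {t : ℝ≥0} (ht : (t : WithTop ℝ≥0) < Loewner.swallowingTime W z)
    (hs : |Loewner.cotArg W z t| ≤ s) :
    Loewner.rsObservable (rsExponent κ) κ W z t ≤
      Loewner.derivRatio W z t ^ rsExponent κ * rsGhatW κ s := by
  have hκ0 : κ ≠ 0 := by positivity
  have hψpos : 0 < Loewner.derivRatio W z t ^ rsExponent κ :=
    Real.rpow_pos_of_pos (lt_of_lt_of_le one_pos (Loewner.one_le_derivRatio hW hz ht)) _
  have hy : (Loewner.centredMap W t z).im ≠ 0 := (Loewner.im_centredMap_pos hW hz ht).ne'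
  rw [Loewner.rsObservable_of_lt ht, rsGhat_rsExponent_eq hκ0 hy, ← Loewner.cotArg_apply]
  exact mul_le_mul_of_nonneg_left (rsGhatW_le_of_abs_le hκ hs) hψpos.le

/-- **On `{T = ∞}` the observable tends to `0`** along integer times (`κ ≥ 8`, exponent
`a(κ) < 0`): either `τ(z) < ∞` and `Mₙ = 0` for `n ≥ τ(z)`, or `τ(z) = ∞`, `|wₜ| < s` for all
`t`, so `ψₜ → ∞` (`Loewner.tendsto_derivRatio_atTop_of_abs_cotArg_le`), `ψₜ^a → 0` and
`Ĝ(zₜ) ≤ Ĝ(s + i)`. ("if `|Re gₜ/Im gₜ|` never hits `|w₀|` [here: `s`], then `Z = ∞`", p. 905.)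
[cite: RohdeSchramm2005, Lemma 6.3] -/
theorem tendsto_sleRSObservable_of_exitTime_eq_top {κ : ℝ≥0} (hκ : 8 ≤ (κ : ℝ)) (hz : 0 < z.im)
    {s : ℝ} {ω : ℝ≥0 → ℝ} (hT : sleCotArgExitTime κ z s ω = ⊤) :
    Tendsto (fun n : ℕ ↦ sleRSObservable κ (rsExponent κ) z n ω) atTop (𝓝 0) := by
  have hW : Continuous (sleDriving κ ω) := continuous_sleDriving κ ω
  have hzW : z ≠ sleDriving κ ω 0 := Loewner.ne_driving_of_im_pos hz 0
  have ha : rsExponent κ < 0 := rsExponent_neg (by linarith) (by linarith)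
  rcases eq_or_ne (Loewner.swallowingTime (sleDriving κ ω) z) ⊤ with hτ | hτ
  · -- `τ = ∞`: `ψₙ → ∞`
    have hs : ∀ t : ℝ≥0, (t : WithTop ℝ≥0) < Loewner.swallowingTime (sleDriving κ ω) z →
        |Loewner.cotArg (sleDriving κ ω) z t| ≤ s :=
      fun t ht ↦ (Loewner.abs_cotArg_lt_of_cotArgExitTime_eq_top (sleDriving κ ω) z hT ht).le
    have hψ := Loewner.tendsto_derivRatio_atTop_of_abs_cotArg_le hW hz hs
    haveI : Nonempty {t : ℝ≥0 //
        (t : WithTop ℝ≥0) < Loewner.swallowingTime (sleDriving κ ω) z} :=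
      ⟨⟨0, Loewner.swallowingTime_pos_holds hW hzW⟩⟩
    have hlt : ∀ n : ℕ, ((n : ℝ≥0) : WithTop ℝ≥0) < Loewner.swallowingTime (sleDriving κ ω) z :=
      fun n ↦ by rw [hτ]; exact WithTop.coe_lt_top _
    have hψn : Tendsto (fun n : ℕ ↦ Loewner.derivRatio (sleDriving κ ω) z n) atTop atTop := by
      refine tendsto_atTop_atTop.2 fun b ↦ ?_
      obtain ⟨i, hi⟩ := tendsto_atTop_atTop.1 hψ b
      refine ⟨⌈((i : ℝ≥0) : ℝ)⌉₊, fun n hn ↦ ?_⟩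
      have hn' : (i : ℝ≥0) ≤ (n : ℝ≥0) := by
        rw [← NNReal.coe_le_coe, NNReal.coe_natCast]
        exact (Nat.le_ceil _).trans (by exact_mod_cast hn)
      exact hi ⟨(n : ℝ≥0), hlt n⟩ hn'
    have hpow : Tendsto (fun n : ℕ ↦ Loewner.derivRatio (sleDriving κ ω) z n ^ rsExponent κ)
        atTop (𝓝 0) := by
      have h := (tendsto_rpow_neg_atTop (neg_pos.2 ha)).comp hψn
      simpa only [neg_neg, Function.comp_def] using h
    have hlim : Tendsto (fun n : ℕ ↦
        Loewner.derivRatio (sleDriving κ ω) z n ^ rsExponent κ * rsGhatW κ s) atTop (𝓝 0) := by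
      simpa using hpow.mul_const (rsGhatW κ s)
    refine squeeze_zero (fun n ↦ (Loewner.rsObservable_mem_Icc hW hz hκ (hlt n)).1)
      (fun n ↦ Loewner.rsObservable_le_rpow_mul hW hz hκ (hlt n) (hs _ (hlt n))) hlim
  · -- `τ = b < ∞`: eventually `Mₙ = 0`
    obtain ⟨b, hb⟩ := WithTop.ne_top_iff_exists.1 hτ
    refine tendsto_const_nhds.congr' ?_
    filter_upwards [eventually_ge_atTop ⌈(b : ℝ)⌉₊] with n hn
    symm
    refine Loewner.rsObservable_of_le ?_
    rw [← hb]
    refine WithTop.coe_le_coe.2 ?_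
    rw [← NNReal.coe_le_coe, NNReal.coe_natCast]
    exact (Nat.le_ceil _).trans (by exact_mod_cast hn)

/-! ### The terminal value `M_T 1{T < ∞}` and the limit of the stopped observable -/

/-- **The terminal value `M_T 𝟙{T < ∞}`** of the observable stopped at the exit time `T` of `|w|`
from `[0, s)`: `M_T` if `T < ∞`, and `0` (the limit of `Mₜ`, `t ↑ τ(z)`) if `T = ∞`.
Rohde–Schramm (2005), p. 905: "`M₀ = E[M_{T_m ∧ tₙ}] → E[M_{T_m}]`". [cite: RohdeSchramm2005, Lemma 6.3] -/
def sleRSExitValue (κ : ℝ≥0) (z : ℂ) (s : ℝ) (ω : ℝ≥0 → ℝ) : ℝ :=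
  {ω' : ℝ≥0 → ℝ | sleCotArgExitTime κ z s ω' ≠ ⊤}.indicator
    (fun ω' ↦ sleRSObservable κ (rsExponent κ) z (sleCotArgExitTime κ z s ω').untopA ω') ω

/-- On `{T = t₀ < ∞}` the terminal value is `M_{t₀}`. [folklore] -/
theorem sleRSExitValue_of_eq_coe {κ : ℝ≥0} {s : ℝ} {ω : ℝ≥0 → ℝ} {t₀ : ℝ≥0}
    (hT : sleCotArgExitTime κ z s ω = t₀) :
    sleRSExitValue κ z s ω = sleRSObservable κ (rsExponent κ) z t₀ ω := by
  have hmem : ω ∈ {ω' : ℝ≥0 → ℝ | sleCotArgExitTime κ z s ω' ≠ ⊤} := by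
    rw [mem_setOf_eq, hT]; exact WithTop.coe_ne_top
  rw [sleRSExitValue, indicator_of_mem hmem, hT, WithTop.untopA_eq_untop WithTop.coe_ne_top,
    WithTop.untop_coe]

/-- On `{T = ∞}` the terminal value is `0`. [folklore] -/
theorem sleRSExitValue_of_eq_top {κ : ℝ≥0} {s : ℝ} {ω : ℝ≥0 → ℝ}
    (hT : sleCotArgExitTime κ z s ω = ⊤) : sleRSExitValue κ z s ω = 0 := by
  rw [sleRSExitValue, indicator_of_notMem]
  rw [mem_setOf_eq, not_not]
  exact hT

/-- **The stopped observable converges to the terminal value** along integer times, for every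
path (`κ ≥ 8`, exponent `a(κ)`): on `{T = t₀}` it is eventually `M_{t₀}`; on `{T = ∞}` it is `Mₙ → 0`
(`tendsto_sleRSObservable_of_exitTime_eq_top`). This is "`M_{T_m ∧ tₙ} → M_{T_m}` as `n → ∞`"
(p. 905). [cite: RohdeSchramm2005, Lemma 6.3] -/
theorem tendsto_stoppedProcess_sleRSObservable {κ : ℝ≥0} (hκ : 8 ≤ (κ : ℝ)) (hz : 0 < z.im)
    (s : ℝ) (ω : ℝ≥0 → ℝ) :
    Tendsto (fun n : ℕ ↦
      stoppedProcess (sleRSObservable κ (rsExponent κ) z) (sleCotArgExitTime κ z s) n ω)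
      atTop (𝓝 (sleRSExitValue κ z s ω)) := by
  rcases eq_or_ne (sleCotArgExitTime κ z s ω) ⊤ with hT | hT
  · rw [sleRSExitValue_of_eq_top hT]
    refine (tendsto_sleRSObservable_of_exitTime_eq_top hκ hz hT).congr fun n ↦ ?_
    exact (stoppedProcess_eq_of_le (by rw [hT]; exact le_top)).symm
  · obtain ⟨t₀, ht₀⟩ := WithTop.ne_top_iff_exists.1 hT
    rw [sleRSExitValue_of_eq_coe ht₀.symm]
    refine tendsto_const_nhds.congr' ?_
    filter_upwards [eventually_ge_atTop ⌈(t₀ : ℝ)⌉₊] with n hn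
    have hle : sleCotArgExitTime κ z s ω ≤ (n : ℝ≥0) := by
      rw [← ht₀]
      refine WithTop.coe_le_coe.2 ?_
      rw [← NNReal.coe_le_coe, NNReal.coe_natCast]
      exact (Nat.le_ceil _).trans (by exact_mod_cast hn)
    rw [stoppedProcess_eq_of_ge hle, ← ht₀, WithTop.untopA_eq_untop WithTop.coe_ne_top,
      WithTop.untop_coe]

/-- The terminal value lies in `[0, Ĝ(s + i)]` when `|w₀| < s` (limit of values in that closed
interval). [cite: RohdeSchramm2005, Lemma 6.3] -/
theorem sleRSExitValue_mem_Icc {κ : ℝ≥0} (hκ : 8 ≤ (κ : ℝ)) (hz : 0 < z.im) {s : ℝ}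
    (h0 : |z.re / z.im| < s) (ω : ℝ≥0 → ℝ) :
    sleRSExitValue κ z s ω ∈ Icc (0 : ℝ) (rsGhatW κ s) :=
  isClosed_Icc.mem_of_tendsto (tendsto_stoppedProcess_sleRSObservable hκ hz s ω)
    (Eventually.of_forall fun n ↦ stoppedProcess_sleRSObservable_mem_Icc hκ hz h0 n ω)

end Pathwise

/-! ### Consequences of the Itô step: `E[M_T; T < ∞] = Ĝ(ẑ)` and Markov's inequality -/

section Martingale

variable {κ : ℝ≥0} {z : ℂ}

/-- **`E[M_{t ∧ T}] = Ĝ(ẑ)`** for every `t` (the martingale identity of the Itô step at times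
`0 ≤ t`, `M₀ = Ĝ(ẑ)`; "`Ĝ(ẑ) = M₀ = E[M_{t̄ₙ}]`", p. 905). [cite: RohdeSchramm2005, Lemma 6.3] -/
theorem integral_stoppedProcess_sleRSObservable (hM : sle_martingale_rsObservable)
    (hκ : 8 ≤ (κ : ℝ)) (hz : 0 < z.im) (s : ℝ) (t : ℝ≥0) :
    ∫ ω, stoppedProcess (sleRSObservable κ (rsExponent κ) z) (sleCotArgExitTime κ z s) t ω
        ∂Process.preWienerMeasure = rsGhatW κ (z.re / z.im) := by
  haveI := isProbabilityMeasure_preWienerMeasure'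
  have hκpos : (0 : ℝ) < κ := by linarith
  have hκpos' : 0 < κ := NNReal.coe_pos.1 hκpos
  have ha : rsExponent κ < 0 := rsExponent_neg hκpos (by linarith)
  have hdisc : 0 ≤ 32 * rsExponent κ * (κ : ℝ) + (2 * (κ : ℝ) - 8) ^ 2 :=
    (discr_rsExponent hκpos.ne').ge
  have hmart := hM hκpos' ha hdisc hz s
  have h1 := hmart.setIntegral_eq (zero_le : (0 : ℝ≥0) ≤ t) (s := univ) MeasurableSet.univ
  rw [setIntegral_univ, setIntegral_univ] at h1
  rw [← h1]
  simp_rw [stoppedProcess_sleRSObservable_zero hκpos'.ne' hz s]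
  rw [integral_const, smul_eq_mul, probReal_univ, one_mul]

/-- Each stopped value `M_{t ∧ T}` is measurable (adaptedness, part of the Itô step). [folklore] -/
theorem measurable_stoppedProcess_sleRSObservable (hM : sle_martingale_rsObservable)
    (hκ : 8 ≤ (κ : ℝ)) (hz : 0 < z.im) (s : ℝ) (t : ℝ≥0) :
    Measurable fun ω ↦
      stoppedProcess (sleRSObservable κ (rsExponent κ) z) (sleCotArgExitTime κ z s) t ω := by
  have hκpos : (0 : ℝ) < κ := by linarith
  have ha : rsExponent κ < 0 := rsExponent_neg hκpos (by linarith)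
  have hdisc : 0 ≤ 32 * rsExponent κ * (κ : ℝ) + (2 * (κ : ℝ) - 8) ^ 2 :=
    (discr_rsExponent hκpos.ne').ge
  have hmart := hM (by exact_mod_cast hκpos) ha hdisc hz s
  exact ((hmart.stronglyMeasurable t).mono (brownianFiltration.le t)).measurable

/-- **`E[M_T 𝟙{T < ∞}] = Ĝ(ẑ)`** (`|w₀| < s`): dominated convergence (`0 ≤ M_{n∧T} ≤ Ĝ(s + i)`,
`M_{n∧T} → M_T 𝟙{T<∞}` for every path) in the martingale identity; and the terminal value is
a.e.-strongly measurable. Rohde–Schramm (2005), p. 905: "The argument of the previous paragraph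
shows that `M₀ = E[M_{T_m∧tₙ}] → E[M_{T_m}]`" (there via the optional sampling theorem and
dominated convergence). [cite: RohdeSchramm2005, Lemma 6.3] -/
theorem integral_sleRSExitValue (hM : sle_martingale_rsObservable) (hκ : 8 ≤ (κ : ℝ))
    (hz : 0 < z.im) {s : ℝ} (h0 : |z.re / z.im| < s) :
    ∫ ω, sleRSExitValue κ z s ω ∂Process.preWienerMeasure = rsGhatW κ (z.re / z.im) ∧
      AEStronglyMeasurable (sleRSExitValue κ z s) Process.preWienerMeasure := by
  haveI := isProbabilityMeasure_preWienerMeasure'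
  set N : ℕ → (ℝ≥0 → ℝ) → ℝ := fun n ω ↦
    stoppedProcess (sleRSObservable κ (rsExponent κ) z) (sleCotArgExitTime κ z s) n ω with hN
  have hmeas : ∀ n, AEStronglyMeasurable (N n) Process.preWienerMeasure := fun n ↦
    (measurable_stoppedProcess_sleRSObservable hM hκ hz s n).aestronglyMeasurable
  have hlim : ∀ᵐ ω ∂Process.preWienerMeasure,
      Tendsto (fun n ↦ N n ω) atTop (𝓝 (sleRSExitValue κ z s ω)) :=
    ae_of_all _ fun ω ↦ tendsto_stoppedProcess_sleRSObservable hκ hz s ω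
  have hbound : ∀ n, ∀ᵐ ω ∂Process.preWienerMeasure, ‖N n ω‖ ≤ rsGhatW κ s := fun n ↦
    ae_of_all _ fun ω ↦ by
      have hm := stoppedProcess_sleRSObservable_mem_Icc hκ hz h0 (n : ℝ≥0) ω
      rw [Real.norm_eq_abs, abs_of_nonneg hm.1]
      exact hm.2
  have hdct := tendsto_integral_of_dominated_convergence (fun _ ↦ rsGhatW κ s) hmeas
    (integrable_const _) hbound hlim
  have hint : ∀ n, ∫ ω, N n ω ∂Process.preWienerMeasure = rsGhatW κ (z.re / z.im) := fun n ↦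
    integral_stoppedProcess_sleRSObservable hM hκ hz s n
  refine ⟨tendsto_nhds_unique hdct ?_, aestronglyMeasurable_of_tendsto_ae atTop hmeas hlim⟩
  simp only [hint]
  exact tendsto_const_nhds

/-- **Markov step**: for `|w₀| < s` and `k ≥ 1`,
`P[ψₜ ≤ k for all t < τ(z)] ≤ Ĝ(ẑ) / (k^a Ĝ(s + i))` (`a = a(κ) < 0`). On that event the exit
time `T` is finite (else `ψ → ∞`, `Loewner.tendsto_derivRatio_atTop_of_abs_cotArg_le`),
`|w_T| = s` and `M_T = ψ_T^a Ĝ(s + i) ≥ k^a Ĝ(s + i)`; then Markov's inequality for the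
terminal value, whose expectation is `Ĝ(ẑ)`. (Rohde–Schramm run "`Ĝ(ẑ) = E[M_{T_m}] → Ĝ(1) E[Z^a]`",
p. 905; this is its quantitative form.) [cite: RohdeSchramm2005, Lemma 6.3] -/
theorem measureReal_forall_sleDerivRatio_le_le (hM : sle_martingale_rsObservable)
    (hκ : 8 ≤ (κ : ℝ)) (hz : 0 < z.im) {s : ℝ} (h0 : |z.re / z.im| < s) {k : ℝ} (hk : 1 ≤ k) :
    Process.preWienerMeasure.real {ω | ∀ t : ℝ≥0,
        (t : WithTop ℝ≥0) < Loewner.swallowingTime (sleDriving κ ω) z →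
          sleDerivRatio κ ω z t ≤ k} ≤
      rsGhatW κ (z.re / z.im) / (k ^ rsExponent κ * rsGhatW κ s) := by
  haveI := isProbabilityMeasure_preWienerMeasure'
  have hκpos : (0 : ℝ) < κ := by linarith
  have ha : rsExponent κ < 0 := rsExponent_neg hκpos (by linarith)
  set c : ℝ := k ^ rsExponent κ * rsGhatW κ s with hc
  have hka : 0 < k ^ rsExponent κ := Real.rpow_pos_of_pos (by linarith) _
  have hcpos : 0 < c := mul_pos hka (rsGhatW_pos hκ s)
  obtain ⟨hint, hV⟩ := integral_sleRSExitValue hM hκ hz h0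
  -- the event is contained in `{c ≤ M_T 1{T<∞}}`
  have hsub : {ω : ℝ≥0 → ℝ | ∀ t : ℝ≥0,
      (t : WithTop ℝ≥0) < Loewner.swallowingTime (sleDriving κ ω) z → sleDerivRatio κ ω z t ≤ k} ⊆
      {ω | c ≤ sleRSExitValue κ z s ω} := by
    intro ω hω
    have hW : Continuous (sleDriving κ ω) := continuous_sleDriving κ ω
    have hzW : z ≠ sleDriving κ ω 0 := Loewner.ne_driving_of_im_pos hz 0
    have h0' : |Loewner.cotArg (sleDriving κ ω) z 0| < s := by rwa [cotArg_sleDriving_zero κ ω hz]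
    -- the exit time is finite
    have hT : sleCotArgExitTime κ z s ω ≠ ⊤ := by
      intro hT
      have hs : ∀ t : ℝ≥0, (t : WithTop ℝ≥0) < Loewner.swallowingTime (sleDriving κ ω) z →
          |Loewner.cotArg (sleDriving κ ω) z t| ≤ s := fun t ht ↦
        (Loewner.abs_cotArg_lt_of_cotArgExitTime_eq_top (sleDriving κ ω) z hT ht).le
      have hψ := Loewner.tendsto_derivRatio_atTop_of_abs_cotArg_le hW hz hs
      haveI : Nonempty {t : ℝ≥0 //
          (t : WithTop ℝ≥0) < Loewner.swallowingTime (sleDriving κ ω) z} :=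
        ⟨⟨0, Loewner.swallowingTime_pos_holds hW hzW⟩⟩
      obtain ⟨t, ht⟩ := (hψ.eventually_gt_atTop k).exists
      exact not_le.2 ht (hω t.1 t.2)
    obtain ⟨t₀, ht₀⟩ := WithTop.ne_top_iff_exists.1 hT
    obtain ⟨hlt, -⟩ := Loewner.lt_swallowingTime_of_cotArgExitTime_eq_coe hW hz ht₀.symm
    have habs : |Loewner.cotArg (sleDriving κ ω) z t₀| = s :=
      Loewner.abs_cotArg_cotArgExitTime hW hz h0' ht₀.symm
    have hy : (Loewner.centredMap (sleDriving κ ω) t₀ z).im ≠ 0 :=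
      (Loewner.im_centredMap_pos hW hz hlt).ne'
    have hψ1 : 1 ≤ Loewner.derivRatio (sleDriving κ ω) z t₀ := Loewner.one_le_derivRatio hW hz hlt
    have hψk : Loewner.derivRatio (sleDriving κ ω) z t₀ ≤ k := hω t₀ hlt
    have hpow : k ^ rsExponent κ ≤ Loewner.derivRatio (sleDriving κ ω) z t₀ ^ rsExponent κ :=
      Real.rpow_le_rpow_of_nonpos (by linarith) hψk ha.le
    show c ≤ sleRSExitValue κ z s ω
    rw [sleRSExitValue_of_eq_coe ht₀.symm, sleRSObservable, Loewner.rsObservable_of_lt hlt,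
      rsGhat_rsExponent_eq hκpos.ne' hy, ← Loewner.cotArg_apply, ← rsGhatW_abs, habs]
    exact mul_le_mul_of_nonneg_right hpow (rsGhatW_pos hκ s).le
  -- Markov's inequality for the terminal value
  have hnonneg : 0 ≤ᵐ[Process.preWienerMeasure] sleRSExitValue κ z s :=
    ae_of_all _ fun ω ↦ (sleRSExitValue_mem_Icc hκ hz h0 ω).1
  have hVint : Integrable (sleRSExitValue κ z s) Process.preWienerMeasure :=
    (integrable_const (rsGhatW κ s)).mono' hV (ae_of_all _ fun ω ↦ by
      have hm := sleRSExitValue_mem_Icc hκ hz h0 ω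
      rw [Real.norm_eq_abs, abs_of_nonneg hm.1]
      exact hm.2)
  have hmarkov := mul_meas_ge_le_integral_of_nonneg hnonneg hVint c
  rw [hint] at hmarkov
  calc Process.preWienerMeasure.real {ω | ∀ t : ℝ≥0,
        (t : WithTop ℝ≥0) < Loewner.swallowingTime (sleDriving κ ω) z → sleDerivRatio κ ω z t ≤ k}
      ≤ Process.preWienerMeasure.real {ω | c ≤ sleRSExitValue κ z s ω} :=
        measureReal_mono hsub (measure_ne_top _ _)
    _ ≤ rsGhatW κ (z.re / z.im) / c := by
        rw [le_div_iff₀ hcpos, mul_comm]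
        exact hmarkov

/-- **A.s. `ψ` is not bounded by `k` on `[0, τ(z))`** (`κ ≥ 8`, `z ∈ ℍ`, `k ≥ 1`): the
probability is at most `Ĝ(ẑ) / (k^a Ĝ(s_m + i))` for every level `s_m = |w₀| + 1 + m`, and
`Ĝ(s_m + i) → ∞` (`tendsto_rsGhatW_atTop`, "`Ĝ(1) = ∞`", pp. 905–906).
[cite: RohdeSchramm2005, Lemma 6.3] -/
theorem measure_forall_sleDerivRatio_le_eq_zero (hM : sle_martingale_rsObservable)
    (hκ : 8 ≤ (κ : ℝ)) (hz : 0 < z.im) {k : ℝ} (hk : 1 ≤ k) :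
    Process.preWienerMeasure {ω | ∀ t : ℝ≥0,
        (t : WithTop ℝ≥0) < Loewner.swallowingTime (sleDriving κ ω) z →
          sleDerivRatio κ ω z t ≤ k} = 0 := by
  haveI := isProbabilityMeasure_preWienerMeasure'
  set w₀ : ℝ := z.re / z.im with hw₀
  set sm : ℕ → ℝ := fun m ↦ |w₀| + 1 + m with hsm
  have h0 : ∀ m, |w₀| < sm m := fun m ↦ by
    simp only [hsm]
    have : (0 : ℝ) ≤ m := Nat.cast_nonneg m
    linarith
  have hka : 0 < k ^ rsExponent κ := Real.rpow_pos_of_pos (by linarith) _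
  have hle : ∀ m, Process.preWienerMeasure.real {ω | ∀ t : ℝ≥0,
      (t : WithTop ℝ≥0) < Loewner.swallowingTime (sleDriving κ ω) z → sleDerivRatio κ ω z t ≤ k} ≤
      rsGhatW κ w₀ / (k ^ rsExponent κ * rsGhatW κ (sm m)) := fun m ↦
    measureReal_forall_sleDerivRatio_le_le hM hκ hz (h0 m) hk
  have hsm_top : Tendsto sm atTop atTop :=
    tendsto_atTop_add_const_left _ _ tendsto_natCast_atTop_atTop
  have hG : Tendsto (fun m ↦ k ^ rsExponent κ * rsGhatW κ (sm m)) atTop atTop :=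
    ((tendsto_rsGhatW_atTop hκ).comp hsm_top).const_mul_atTop hka
  have hlim : Tendsto (fun m ↦ rsGhatW κ w₀ / (k ^ rsExponent κ * rsGhatW κ (sm m))) atTop (𝓝 0) :=
    tendsto_const_nhds.div_atTop hG
  have hreal : Process.preWienerMeasure.real {ω | ∀ t : ℝ≥0,
      (t : WithTop ℝ≥0) < Loewner.swallowingTime (sleDriving κ ω) z → sleDerivRatio κ ω z t ≤ k} = 0 :=
    le_antisymm (ge_of_tendsto' hlim hle) measureReal_nonneg
  exact (measureReal_eq_zero_iff (measure_ne_top _ _)).1 hreal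

end Martingale

/-! ### Lemma 6.3 for `κ ≥ 8` and the space-filling phase from the Itô step -/

/-- **Rohde–Schramm (2005), Lemma 6.3, case `κ ≥ 8`, PROVED from the Itô step**
(`sle_martingale_rsObservable`, hypothesis `hM`): for `κ ≥ 8` and `z ∈ ℍ`, almost surely
`ψₜ = (Im z) |gₜ'(z)| / Im gₜ(z) → ∞` as `t ↑ τ(z)`. Almost surely `ψ` is not bounded by any
`k ∈ ℕ` on `[0, τ(z))` (`measure_forall_sleDerivRatio_le_eq_zero`); being non-decreasing
(`monotone_sleDerivRatio`, (6.3)) it tends to `∞`. [cite: RohdeSchramm2005, Lemma 6.3] -/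
theorem tendsto_sleDerivRatio_atTop_of_eight_le_of_martingale (hM : sle_martingale_rsObservable) :
    tendsto_sleDerivRatio_atTop_of_eight_le := by
  intro κ hκ z hz
  have hκ' : 8 ≤ (κ : ℝ) := by exact_mod_cast hκ
  have hzim : 0 < z.im := hz
  have hae : ∀ k : ℕ, ∀ᵐ ω ∂Process.preWienerMeasure, ¬ ∀ t : ℝ≥0,
      (t : WithTop ℝ≥0) < Loewner.swallowingTime (sleDriving κ ω) z →
        sleDerivRatio κ ω z t ≤ (k : ℝ) + 1 := by
    intro k
    rw [ae_iff]
    simp only [not_not]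
    exact measure_forall_sleDerivRatio_le_eq_zero hM hκ' hzim (by linarith [(k.cast_nonneg : (0:ℝ) ≤ k)])
  filter_upwards [ae_all_iff.2 hae] with ω hω
  refine tendsto_atTop_atTop_of_monotone (monotone_sleDerivRatio κ ω hz) fun b ↦ ?_
  obtain ⟨k, hk⟩ := exists_nat_ge b
  have h := hω k
  push Not at h
  obtain ⟨t, ht, hlt⟩ := h
  exact ⟨⟨t, ht⟩, by linarith⟩

/-- Lemma 6.3 (`κ ≥ 8`) in the integral form (6.3) from the Itô step: a.s.
`∫₀ᵗ 4 yₛ² |zₛ|⁻⁴ ds → ∞` as `t ↑ τ(z)`. [cite: RohdeSchramm2005, Lemma 6.3 and eq. (6.3)] -/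
theorem tendsto_integral_derivRatioRate_atTop_of_eight_le_of_martingale
    (hM : sle_martingale_rsObservable) : tendsto_integral_derivRatioRate_atTop_of_eight_le :=
  tendsto_sleDerivRatio_atTop_of_eight_le_iff.1 (tendsto_sleDerivRatio_atTop_of_eight_le_of_martingale hM)

section CritPerc

/-- **crit-perc.S20, space-filling phase `κ ≥ 8`, from three trace theorems and one Itô step**
(Rohde–Schramm, Ann. Math. 161 (2005), Cor. 7.4 and its Update, p. 911):
`ae_isSpaceFilling_sleTrace_of_eight_le` follows from SLE₈ being generated by a curve
(`hasSLETrace_eight`, Lawler–Schramm–Werner (2004), Thm 4.7; `h8`), the Rohde–Schramm theorem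
(`hasSLETrace_of_ne_eight`, RS05 Thm 5.1; `hne`), transience of the trace
(`tendsto_norm_sleTrace_atTop`, RS05 Thm 7.1 + Update; `htr`) and the Itô step of Lemma 6.3
(`sle_martingale_rsObservable`; `hM`). Every other ingredient of the printed proofs of Cor. 7.4
and Lemma 6.3 (`κ ≥ 8`) — (6.2), (6.3), the exit-time analysis, `Ĝ(1) = ∞`, dominated
convergence and Markov — is proved in `Literature`. [cite: RohdeSchramm2005, Cor. 7.4 and Update (p. 911)] -/
theorem ae_isSpaceFilling_sleTrace_of_eight_le_of_itoFacts (h8 : hasSLETrace_eight)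
    (hne : hasSLETrace_of_ne_eight) (htr : tendsto_norm_sleTrace_atTop)
    (hM : sle_martingale_rsObservable) {κ : ℝ≥0} :
    ae_isSpaceFilling_sleTrace_of_eight_le (κ := κ) :=
  ae_isSpaceFilling_sleTrace_of_eight_le_of_core_facts h8 hne htr
    (tendsto_sleDerivRatio_atTop_of_eight_le_of_martingale hM)

end CritPerc

end Literature.Probability.RandomPlanarGeometry

end
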